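import Literature.MathematicalPhysics.QuantumFieldTheory.Balaban1983to89.B9Thm313WholeDirInputBZCut

/-!
# `Balaban1983to89.B9Thm313WholeDirInputBZCutFamily` — [B9] Theorem 3.13 (p. 426): the (3.44) ∕ (3.45) input-Hölder lines of 𝔊 ON THE
# DIRECTION-PAIR FAMILY (`B9Thm313WholeDirInputBZ.GG_input44Family ∕ 45Family_of_lettersBZ`) RE-ISSUED over the kept fields `gQs2 q1 c1_1` of
# `Letters313Z` — reader layer under the N06 LETTERS-SPECIES re-cut (WANTED №g26-7); sequel of `B9Thm313WholeDirInputBZCut` (the per-pair lines)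

T. Bałaban, *Propagators for lattice gauge theories in a background field*, Commun. Math. Phys. **99** (1985) 389–434
[`Balaban1985BackgroundPropagators`, "B9"]; [4] = T. Bałaban, *Propagators and renormalization transformations for lattice gauge
theories. II*, Commun. Math. Phys. **96** (1984) 223–250 [`Balaban1984PropagatorsII`].

statement-level skeleton of published theorems with citation tags; proofs where landed; nothing here is a claim about the Yang–Mills
mass gap

THE POINT (cell `pub/ym-inputs` seat p04 g2; see `B9Thm313WholeDirInputBZCut`).  The two FAMILY packagings of the per-pair (3.44)∕(3.45) lines —
the members the PairMB leaf `B9Thm313WholeBlocksPairMBZ.GG_holder_pairMBZ` actually calls (:245, :260) — re-issued over the kept fields, calling the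
per-pair re-issues `GG_input44m ∕ 45m_cut_of_lettersB`; statements of the parents with `hL : Letters313Z …` ↦ `hLgQs2 hLq1 hLc1_1`, everything else
byte-identical, proofs verbatim:
* ★ `GG_input44Family_cut_of_lettersB`, ★ `GG_input45Family_cut_of_lettersB`.

HONEST SCOPE.  Kernel bookkeeping over landed modules; the kept letters stay HYPOTHESES of printed species; nothing of [B9]'s estimates is asserted;
COUNT-NEUTRAL; N06 NOT discharged; no summit or sub-problem statement is proved (YM₃ on T³ = ladder rung R3, a RECORD rung — not T⁴, not a mass
gap, not Clay).  One finite lattice at a time.  Seat `ym-inputs-p04` g2 (prover-ym-inputs-p04-g2-0), 2026-08-28; NEW file, nothing landed is modified.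
-/

namespace Literature.MathematicalPhysics.QuantumFieldTheory.Balaban1983to89.B9Thm313WholeDirInputBZCutFamily

open Literature.MathematicalPhysics.QuantumFieldTheory.Balaban1983to89
open Finset B6RandomWalk B6RandomWalkHom B9Thm34Ext B9Thm37GlueCor36 B11SectG B9SectDSup
open B9Thm37AllNorms B9Thm37AllNormsInstances B9Thm312Whole B9Thm312WholeLeaf B9Thm312WholeLeft B9Thm313Whole B9Thm313WholeLeft
open B9RWSums343Holder B9Ineq347 B9Thm312WholeClasses B9Thm312WholeHolder B9Thm312WholeHHolder B9Thm313WholeHolder B9Thm313WholeInput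
open B9RWSums346SecondDiff B9RWSums344InputFam B9Thm312WholeDir B9Thm313WholeDir B9Thm313WholeDirInput B9Thm312WholeDirB
open B9Thm313WholeDirInputB B9Thm313WholeZ B9Thm313WholeLeftZ B9Thm313WholeHolderZ B9Thm313WholeInputZ B9Thm313WholeDirZ
open B9Thm313WholeDirInputZ B9Thm313WholeDirInputBZ B9Thm313WholeDirInputBZCut

noncomputable section

section OneMember

variable {g : B9.Geometry} {B : B9.Backgrounds} {X Y Z W PX PY P : Type}
variable [Fintype X] [Fintype Y] [Fintype Z] [Fintype W] [Fintype PX] [Fintype PY] [Fintype P] [Fintype g.Site]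
variable {R₀ : ℝ} {H₀ : Prop}

omit [Fintype Y] in
/-- (**KEPT-FIELD RE-ISSUE** of `B9Thm313WholeDirInputBZ.GG_input44Family_of_lettersBZ`: the binder `hL : Letters313Z …` replaced by its field(s) `gQs2` (G₀Q\* : Z_{wZ} → 𝔠⁽²⁾), `q1`, `c1_1` (the last two handed to `GG_input_of_piecesF_cut`) as hypotheses, types verbatim; every other binder, the conclusion and the constant unchanged; proof verbatim.) ★ **(3.44) FOR 𝔊 ON THE PACKAGED PAIR FAMILY, ε-INDEXED CONSTANTS** (B-twin) — `GG_input44m_of_lettersBZ` for every pair, packaged WITHOUT a |P| factor (`hasMaj_familyOp'`: sup sizes):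
the family `familyOp (q ↦ ∇_{U,q.1} ∘ 𝔊 ∘ ∇\*_{U,q.2})` read from `bHX ε` into the sharp blocks of X × (P × P) (block map `blk ∘ Prod.fst`) — the input `h44`
of n06-k's `lines3445_of_hasMaj_fam` for 𝔊's kernel family. [cite: Balaban1985BackgroundPropagators, Thm 3.13 p.426 + (3.44) p.398 + (3.39) p.397] -/
theorem GG_input44Family_cut_of_lettersB (hG : GeoOK g) (𝔭 : HolderProbes g B X Y PX PY) {𝔬 : Ops g B X Y Z W} {U : B.Cfg}
    {Dd Dds : B.Cfg → P → Module.End ℝ (X → ℝ)}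
    {bHX : ℝ → BlockNorm (toB6 g R₀ H₀) (X → ℝ)} {bHW : ℝ → BlockNorm (toB6 g R₀ H₀) (W → ℝ)} {bH : BlockNorm (toB6 g R₀ H₀) (W → ℝ)}
    {Bh Bi Bq Bd θH θI θv Br : ℝ → ℝ} {Bi2 Bd2 : ℝ → ℝ → ℝ} {θ θD B₀ B₃ δ₀ δ₃ δK r ρ₄ α Λ σ c ε : ℝ}
    (hrow : RowSum (toB6 g R₀ H₀) σ c)
    (hc : 0 ≤ c) (hθ : 0 ≤ θ) (hθD : 0 ≤ θD) (hθH : 0 ≤ θI ε) (hθv : 0 ≤ θv ε) (hB₀ : 0 ≤ B₀) (hB₃ : 0 ≤ B₃) (hBi : 0 ≤ Bi ε)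
    (hBd : 0 ≤ Bd ε) (hBr : 0 ≤ Br ε) (hΛ : 0 ≤ Λ) (hα : 0 ≤ α) (hσ : 0 ≤ σ) (hε0 : 0 < ε) (hε1 : ε ≤ 1) (hρ₄ : 0 ≤ ρ₄)
    (hρ₄r : ρ₄ + 3 * σ ≤ (1 - α) * r) (hr : 0 ≤ r) (hr0 : r ≤ δ₀) (hr₃ : r ≤ δ₃) (hrK : r + σ ≤ δK) (hq : θ * c < 1)
    (hST : ScaleTransfer g r α Λ (fun y => g.len y ^ (1 : ℝ)))
    (hK1 : HasMaj (cNorm R₀ H₀ 𝔬.blk hG.lenle 1) (cNorm R₀ H₀ 𝔬.blk hG.lenle 1) (𝔬.G0 U ∘ₗ (𝔬.Tpi U + 𝔬.T2 U))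
      (fun a b => θ * Real.exp (-(δK * g.dist a b))))
    (hK2 : HasMaj (cNorm R₀ H₀ 𝔬.blk hG.lenle 2) (cNorm R₀ H₀ 𝔬.blk hG.lenle 2) (𝔬.G0 U ∘ₗ (𝔬.Tpi U + 𝔬.T2 U))
      (fun a b => θ * Real.exp (-(δK * g.dist a b))))
    (he0 : HasMajorant (g := toB6 g R₀ H₀) 𝔬.blk (𝔬.G0 U) (fun a b => B₀ * g.len a ^ 2 * Real.exp (-(δ₀ * g.dist a b))))
    (hH0 : Thm33G0Dir 𝔬 𝔭 Dd Dds R₀ H₀ bHX B₀ Bh Bi Bi2 δ₀ U) (hHR : Thm33G0DirR 𝔬 Dds R₀ H₀ B₀ δ₀ U)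
    (hSD : StepDirB 𝔬 𝔭 Dd Dds R₀ H₀ bHX hG.lenle θD θH θI δK U)
    (wZ : g.Site → ℝ) (hwZ : ∀ y, 0 < wZ y)
    (hLgQs2 : HasMaj (weightNorm (BlockNorm.ofBlocks (toB6 g R₀ H₀) 𝔬.blkZ) wZ fun y => (hwZ y).le) (cNorm R₀ H₀ 𝔬.blk hG.lenle 2)
      (𝔬.G0 U ∘ₗ 𝔬.Qstar U) (fun a b => B₃ * Real.exp (-(δ₃ * g.dist a b))))
    (hLq1 : HasMaj (cNorm R₀ H₀ 𝔬.blk hG.lenle 1) (cNorm R₀ H₀ 𝔬.blkZ hG.lenle 1) (𝔬.Q U) (fun a b => B₃ * Real.exp (-(δ₃ * g.dist a b))))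
    (hLc1_1 : HasMaj (cNorm R₀ H₀ 𝔬.blkZ hG.lenle 1)
      (weightNorm (BlockNorm.ofBlocks (toB6 g R₀ H₀) 𝔬.blkZ) (fun y => g.len y * wZ y) fun y => (wZlen_pos hG hwZ y).le) (𝔬.C1 U)
      (fun a b => B₃ * Real.exp (-(δ₃ * g.dist a b))))
    (hLDM : Letters313DMZ 𝔬 𝔭 Dd R₀ H₀ hG wZ hwZ B₃ Bq δ₃ bH U)
    (hLIM : Letters313IMB 𝔬 𝔭 Dd Dds R₀ H₀ hG.lenle bHX bHW Br θv Bd Bd2 δ₃ δK U) (hI : Identities 𝔬 U) :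
    HasMaj (bHX ε) (BlockNorm.ofBlocks (toB6 g R₀ H₀) (𝔬.blk ∘ Prod.fst))
      (familyOp (fun q : P × P => Dd U q.1 ∘ₗ (𝔬.GG U ∘ₗ Dds U q.2)))
      (fun (a b : g.Site) => constI44 θ θD (θI ε) (θv ε) B₀ B₃ (Bi ε) (Bd ε) (Br ε) Λ (bHW ε).κ c * Real.exp (-(ρ₄ * g.dist a b))) := by
  have hinv1 : 0 ≤ (1 - θ * c)⁻¹ := inv_nonneg.mpr (by linarith)
  have hK0 : 0 ≤ constI44 θ θD (θI ε) (θv ε) B₀ B₃ (Bi ε) (Bd ε) (Br ε) Λ (bHW ε).κ c := by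
    have hκ := (bHW ε).κ_nonneg
    unfold constI44
    positivity
  exact hasMaj_familyOp' (R := R₀) (H := H₀) 𝔬.blk (fun a b => mul_nonneg hK0 (Real.exp_nonneg _))
    fun q => GG_input44m_cut_of_lettersB hG 𝔭 hrow hc hθ hθD hθH hθv hB₀ hB₃ hBi hBd hBr hΛ hα hσ hε0 hε1 hρ₄ hρ₄r hr hr0 hr₃ hrK hq
      hST hK1 hK2 he0 hH0 hHR hSD wZ hwZ hLgQs2 hLq1 hLc1_1 hLDM hLIM hI q.1 q.2

omit [Fintype Y] in
/-- (**KEPT-FIELD RE-ISSUE** of `B9Thm313WholeDirInputBZ.GG_input45Family_of_lettersBZ`: the binder `hL : Letters313Z …` replaced by its field(s) `gQs2` (G₀Q\* : Z_{wZ} → 𝔠⁽²⁾), `q1`, `c1_1` (the last two handed to `GG_input_of_piecesF_cut`) as hypotheses, types verbatim; every other binder, the conclusion and the constant unchanged; proof verbatim.) ★ **(3.45) FOR 𝔊 ON THE PACKAGED PAIR FAMILY, PROBES SLICED, β∕ε-INDEXED CONSTANTS, COARSE LETTERS RE-CLASSED** (Z-twin) — `GG_input45m_of_lettersBZ` for every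 pair, the X-probes sliced over the family
(`sliceProbe_comp_familyOp`) and packaged without a |P| factor (`hasMaj_familyOp'`): `sliceProbe Φ^X_β ∘ familyOp (q ↦ ∇_{U,q.1}𝔊∇\*_{U,q.2})` read from
`bHX (β+ε)` into the probe blocks (block map `blkPX ∘ Prod.fst`) — the input `h45` of n06-k's `lines3445_of_hasMaj_fam` for 𝔊's kernel family.
[cite: Balaban1985BackgroundPropagators, Thm 3.13 p.426 + (3.45) p.398 + (3.39)–(3.40) p.397] -/
theorem GG_input45Family_cut_of_lettersB (hG : GeoOK g) (𝔭 : HolderProbes g B X Y PX PY) {𝔬 : Ops g B X Y Z W} {U : B.Cfg}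
    {Dd Dds : B.Cfg → P → Module.End ℝ (X → ℝ)}
    {bHX : ℝ → BlockNorm (toB6 g R₀ H₀) (X → ℝ)} {bHW : ℝ → BlockNorm (toB6 g R₀ H₀) (W → ℝ)} {bH : BlockNorm (toB6 g R₀ H₀) (W → ℝ)}
    {Bh Bi Bq Bd θH θI θv Br : ℝ → ℝ} {Bi2 Bd2 : ℝ → ℝ → ℝ} {θ θD B₀ B₃ β δ₀ δ₃ δK r ρ₄ α Λ σ c ε : ℝ}
    (hrow : RowSum (toB6 g R₀ H₀) σ c)
    (hc : 0 ≤ c) (hθ : 0 ≤ θ) (hθH : 0 ≤ θH β) (hθv : 0 ≤ θv (β + ε)) (hB₀ : 0 ≤ B₀) (hB₃ : 0 ≤ B₃)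
    (hBh : 0 ≤ Bh β) (hBi2 : 0 ≤ Bi2 ε β)
    (hBq : 0 ≤ Bq β) (hBd2 : 0 ≤ Bd2 ε β) (hBr : 0 ≤ Br (β + ε)) (hΛ : 0 ≤ Λ) (hα : 0 ≤ α) (hσ : 0 ≤ σ) (hε0 : 0 < ε) (hε1 : ε ≤ 1)
    (hβ0 : 0 ≤ β) (hβ1 : β < 1) (hρ₄ : 0 ≤ ρ₄) (hρ₄r : ρ₄ + 3 * σ ≤ (1 - α) * r) (hr : 0 ≤ r) (hr0 : r ≤ δ₀) (hr₃ : r ≤ δ₃)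
    (hrK : r + σ ≤ δK) (hq : θ * c < 1) (hST : ScaleTransfer g r α Λ (fun y => g.len y ^ (1 : ℝ)))
    (hK1 : HasMaj (cNorm R₀ H₀ 𝔬.blk hG.lenle 1) (cNorm R₀ H₀ 𝔬.blk hG.lenle 1) (𝔬.G0 U ∘ₗ (𝔬.Tpi U + 𝔬.T2 U))
      (fun a b => θ * Real.exp (-(δK * g.dist a b))))
    (hK2 : HasMaj (cNorm R₀ H₀ 𝔬.blk hG.lenle 2) (cNorm R₀ H₀ 𝔬.blk hG.lenle 2) (𝔬.G0 U ∘ₗ (𝔬.Tpi U + 𝔬.T2 U))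
      (fun a b => θ * Real.exp (-(δK * g.dist a b))))
    (he0 : HasMajorant (g := toB6 g R₀ H₀) 𝔬.blk (𝔬.G0 U) (fun a b => B₀ * g.len a ^ 2 * Real.exp (-(δ₀ * g.dist a b))))
    (hH0 : Thm33G0Dir 𝔬 𝔭 Dd Dds R₀ H₀ bHX B₀ Bh Bi Bi2 δ₀ U) (hHR : Thm33G0DirR 𝔬 Dds R₀ H₀ B₀ δ₀ U)
    (hSD : StepDirB 𝔬 𝔭 Dd Dds R₀ H₀ bHX hG.lenle θD θH θI δK U)
    (wZ : g.Site → ℝ) (hwZ : ∀ y, 0 < wZ y)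
    (hLgQs2 : HasMaj (weightNorm (BlockNorm.ofBlocks (toB6 g R₀ H₀) 𝔬.blkZ) wZ fun y => (hwZ y).le) (cNorm R₀ H₀ 𝔬.blk hG.lenle 2)
      (𝔬.G0 U ∘ₗ 𝔬.Qstar U) (fun a b => B₃ * Real.exp (-(δ₃ * g.dist a b))))
    (hLq1 : HasMaj (cNorm R₀ H₀ 𝔬.blk hG.lenle 1) (cNorm R₀ H₀ 𝔬.blkZ hG.lenle 1) (𝔬.Q U) (fun a b => B₃ * Real.exp (-(δ₃ * g.dist a b))))
    (hLc1_1 : HasMaj (cNorm R₀ H₀ 𝔬.blkZ hG.lenle 1)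
      (weightNorm (BlockNorm.ofBlocks (toB6 g R₀ H₀) 𝔬.blkZ) (fun y => g.len y * wZ y) fun y => (wZlen_pos hG hwZ y).le) (𝔬.C1 U)
      (fun a b => B₃ * Real.exp (-(δ₃ * g.dist a b))))
    (hLDM : Letters313DMZ 𝔬 𝔭 Dd R₀ H₀ hG wZ hwZ B₃ Bq δ₃ bH U)
    (hLIM : Letters313IMB 𝔬 𝔭 Dd Dds R₀ H₀ hG.lenle bHX bHW Br θv Bd Bd2 δ₃ δK U) (hI : Identities 𝔬 U) :
    HasMaj (bHX (β + ε)) (BlockNorm.ofBlocks (toB6 g R₀ H₀) (𝔭.blkPX ∘ Prod.fst))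
      (sliceProbe (𝔭.ΦX U β) ∘ₗ familyOp (fun q : P × P => Dd U q.1 ∘ₗ (𝔬.GG U ∘ₗ Dds U q.2)))
      (fun (a b : g.Site) => constI45 θ (max (θH β) (θI (β + ε))) (θv (β + ε)) B₀ B₃ (Bh β) (Bi2 ε β) (Bd2 ε β) (Bq β) (Br (β + ε)) Λ
        (bHW (β + ε)).κ c * g.len a ^ (-β) * Real.exp (-(ρ₄ * g.dist a b))) := by
  have hinv1 : 0 ≤ (1 - θ * c)⁻¹ := inv_nonneg.mpr (by linarith)
  have hK0 : 0 ≤ constI45 θ (max (θH β) (θI (β + ε))) (θv (β + ε)) B₀ B₃ (Bh β) (Bi2 ε β) (Bd2 ε β) (Bq β) (Br (β + ε)) Λ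
      (bHW (β + ε)).κ c := by
    have hκ := (bHW (β + ε)).κ_nonneg
    unfold constI45
    positivity
  rw [sliceProbe_comp_familyOp]
  refine hasMaj_familyOp' (R := R₀) (H := H₀) 𝔭.blkPX
    (fun a b => mul_nonneg (mul_nonneg hK0 (Real.rpow_nonneg (hG.lenle a) _)) (Real.exp_nonneg _)) fun q => ?_
  have h := GG_input45m_cut_of_lettersB hG 𝔭 hrow hc hθ hθH hθv hB₀ hB₃ hBh hBi2 hBq hBd2 hBr hΛ hα hσ hε0 hε1 hβ0 hβ1 hρ₄ hρ₄r hr hr0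
    hr₃ hrK hq hST hK1 hK2 he0 hH0 hHR hSD wZ hwZ hLgQs2 hLq1 hLc1_1 hLDM hLIM hI q.1 q.2
  exact h.congr fun μ => rfl

end OneMember

end

end Literature.MathematicalPhysics.QuantumFieldTheory.Balaban1983to89.B9Thm313WholeDirInputBZCutFamily
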